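import Summits.MatrixMultiplication.OmegaCensus.STPP222SqFrom24

/-!
# ω-census, small STPP patterns: the GENERIC SEED BRIDGE for order laws (arbitrary prime-power lists, caps and prime classes)

HONEST FRAMING (pub-omega census; verbatim): lottery ticket; floor = certified bounds/negative ranges.
Census STRUCTURE tool of the STPP track (seat pub-omega-stpp-3, gen 26; STRUCTURE row B5 / §2 C10), not progress on `ω`.

The order laws «every finite abelian group of order `≥ N` hosts the pattern `P^k`» of this directory (`STPP222CubeFrom46`,
`STPPSmallPatternOnsetLaws`, `…T2K4/K5/K6OrderLaw`, ENG2's `…T1K6/K7OrderLaw`) all run: exponent large ⇒ a cyclic ray; exponent `E` small ⇒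
structure theorem, the multiset `M` of the nontrivial prime-power factors (each dividing `E`, product `= |G| ≥ N`) is CAPPED (`M ∩ C_E`, product still
`≥ N` because every cap alone reaches `N`), a kernel DOMINATION CORE maps every capped multiset onto a host SEED type, and the seed group embeds
(`exists_emb_of_dom`).  So far the capping data were the fixed `ppList` / `cap` / `capList` of `STPP222CubeFrom46` (prime powers `≤ 45`, caps sized
for the threshold `46`), which forced by-hand cases above `46` (`…T2K5/K6OrderLaw`: prime exponents `47 … 61`, `49`, three factors `ℤ/7`).

This file states the bridge ONCE for ARBITRARY data: any threshold `N`, exponent bound `Emax`, cap-list function `CL : ℕ → List (ℕ × ℕ)` and any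
class of primes `P` (e.g. `P p := p ≠ 2` for laws about groups of odd order); it introduces no definitions:

* (capping keeps the product `≥ N` when every cap alone reaches `N`: the tree's `prod_inter_ge_of`;)
* `exists_seed_emb_of_core` — if (i) for every `1 ≤ E ≤ Emax` and every prime power `p^k ∣ E` with `P p` the cap multiset `capMS (CL E)` contains
  `p^k` often enough that `(p^k)^(count) ≥ N`, and (ii) every sub-multiset of `capMS (CL E)` with product `≥ N` dominates a seed of the list `L`
  (the kernel core), then every finite abelian group `G` with all prime divisors of `|G|` in `P`, exponent `≤ Emax` and `|G| ≥ N` contains an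
  embedded copy of some seed type `SeedType s`, `s ∈ L`;
* `exists_isSTPP_cards_of_core` — the same followed by transport of an STPP family of any size pattern `(a, b, c)^k` from the seed;
* `cap_hyp_of_filterMap` — hypothesis (i) for cap lists `(PP.filter (· ∣ E)).map fun w => (w, c w)` from two finite tables;
* `exists_isSTPP_cards_of_exponent_ge` — the large-exponent branch (a cyclic ray transported along an element of maximal order).

Both hypotheses (i), (ii) are `decide`-shaped once `CL`, `L`, `N`, `Emax` are literals (with (i) reduced to a finite prime-power table by the user).

References: H. Cohn, R. Kleinberg, B. Szegedy, C. Umans, FOCS 2005 (arXiv:math/0511460), Def. 5.1 (tree `IsSTPP`); the structure theorem is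
Mathlib's `AddCommGroup.equiv_directSum_zmod_of_finite`.
-/

open Literature.Computability.AlgebraicComplexity Finset

namespace Summit.MatrixMultiplication.OmegaCensus

/-! ## 1. Capping with a general threshold

The capping inequality for a general threshold `N` is the tree's `prod_inter_ge_of` (`STPP222SqFrom24.lean`): if every element `a` of `M`
satisfies `N ≤ a ^ count a C` and `1 ≤ a`, and `N ≤ M.prod`, then `N ≤ (M ∩ C).prod`. -/

/-! ## 2. The structure-theorem step with arbitrary capping data -/

/-- **GENERIC SEED BRIDGE.** Let `P` be a class of primes, `N` a threshold, `Emax` an exponent bound, `CL E` a list of (prime power, cap) pairs for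
each `E`, and `L` a list of seed types.  Suppose (i) for every `1 ≤ E ≤ Emax` and every prime power `p^k ∣ E` with `p ∈ P`, `k ≥ 1`:
`N ≤ (p^k) ^ count (p^k) (capMS (CL E))`; (ii) every sub-multiset of `capMS (CL E)` with product `≥ N` dominates some `s ∈ L`.  Then every finite
abelian group whose order has all prime divisors in `P`, of exponent `≤ Emax` and order `≥ N`, contains an embedded seed group `SeedType s`, `s ∈ L`.
[folklore] -/
theorem exists_seed_emb_of_core (P : ℕ → Prop) {N Emax : ℕ} (CL : ℕ → List (ℕ × ℕ)) {L : List (List ℕ)}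
    (hcap : ∀ E ∈ List.range' 1 Emax, ∀ p k : ℕ, p.Prime → P p → 0 < k → p ^ k ∣ E →
      N ≤ (p ^ k) ^ Multiset.count (p ^ k) (capMS (CL E)))
    (hcore : ∀ E ∈ List.range' 1 Emax, ∀ M ∈ subMS (CL E), N ≤ M.prod → ∃ s ∈ L, dom s M = true)
    {G : Type*} [AddCommGroup G] [Finite G] (hP : ∀ p : ℕ, p.Prime → p ∣ Nat.card G → P p)
    (hexp : AddMonoid.exponent G ≤ Emax) (hG : N ≤ Nat.card G) :
    ∃ s ∈ L, ∃ φ : SeedType s →+ G, Function.Injective φ := by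
  classical
  obtain ⟨ι, _, p, hp, e, ⟨g⟩⟩ := AddCommGroup.equiv_directSum_zmod_of_finite G
  let f : G ≃+ (Π i, ZMod (p i ^ e i)) :=
    g.trans (DirectSum.linearEquivFunOnFintype ℕ ι (fun i => ZMod (p i ^ e i))).toAddEquiv
  have hE1 : 1 ≤ AddMonoid.exponent G := Nat.pos_of_ne_zero AddMonoid.exponent_ne_zero_of_finite
  have hdvd : ∀ i, p i ^ e i ∣ AddMonoid.exponent G := fun i => by
    have hinj : Function.Injective (AddMonoidHom.single (fun j => ZMod (p j ^ e j)) i) :=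
      Pi.single_injective (M := fun j => ZMod (p j ^ e j)) i
    have h1 : addOrderOf (f.symm (AddMonoidHom.single (fun j => ZMod (p j ^ e j)) i 1)) = p i ^ e i := by
      rw [AddEquiv.addOrderOf_eq, addOrderOf_injective _ hinj, ZMod.addOrderOf_one]
    rw [← h1]
    exact AddMonoid.addOrder_dvd_exponent _
  have hq0 : ∀ i, p i ^ e i ≠ 0 := fun i => pow_ne_zero _ (hp i).ne_zero
  set M : Multiset ℕ := (Finset.univ.filter fun i => 0 < e i).val.map fun i => p i ^ e i with hM
  have hprodeq : M.prod = ∏ i, p i ^ e i := by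
    rw [hM, ← Finset.prod_eq_multiset_prod]
    exact Finset.prod_filter_of_ne fun i _ hi => Nat.pos_of_ne_zero fun h0 => hi (by rw [h0, pow_zero])
  have hcardeq : Nat.card G = ∏ i, p i ^ e i := by
    rw [Nat.card_congr f.toEquiv, Nat.card_pi]
    simp [Nat.card_zmod]
  have hEI : AddMonoid.exponent G ∈ List.range' 1 Emax := List.mem_range'_1.2 ⟨hE1, by omega⟩
  set C := capMS (CL (AddMonoid.exponent G)) with hC
  have hprodN : N ≤ M.prod := by rw [hprodeq, ← hcardeq]; exact hG
  have hmemM : ∀ a ∈ M, ∃ i, 0 < e i ∧ a = p i ^ e i := by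
    intro a ha
    obtain ⟨i, hi, rfl⟩ := Multiset.mem_map.1 ha
    exact ⟨i, (Finset.mem_filter.1 hi).2, rfl⟩
  have hpos : ∀ a ∈ M, 1 ≤ a := by
    intro a ha
    obtain ⟨i, hi, rfl⟩ := hmemM a ha
    exact Nat.one_le_iff_ne_zero.2 (hq0 i)
  have hcapM : ∀ a ∈ M, N ≤ a ^ Multiset.count a C := by
    intro a ha
    obtain ⟨i, hi, rfl⟩ := hmemM a ha
    have hPi : P (p i) := hP (p i) (hp i) (by
      rw [hcardeq]
      exact dvd_trans (dvd_pow_self (p i) hi.ne') (Finset.dvd_prod_of_mem _ (Finset.mem_univ i)))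
    exact hcap _ hEI (p i) (e i) (hp i) hPi hi (hdvd i)
  have hcapd := prod_inter_ge_of (C := C) hprodN hpos hcapM
  have hsub : M ∩ C ∈ subMS (CL (AddMonoid.exponent G)) := mem_subMS_of_le _ _ Multiset.inter_le_right
  obtain ⟨s, hs, hD⟩ := hcore _ hEI (M ∩ C) hsub hcapd
  obtain ⟨φ, hφ, -⟩ := exists_emb_of_dom (fun i => p i ^ e i) hq0 s _ (dom_mono s Multiset.inter_le_left hD)
  exact ⟨s, hs, f.symm.toAddMonoidHom.comp φ, f.symm.injective.comp hφ⟩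

/-! ## 2b. Cap lists built from a prime-power list and a cap function

The cap lists of the laws are `(PP.filter (· ∣ E)).map fun w => (w, c w)` for a list of prime powers `PP` and a cap function `c`
(`STPP222CubeFrom46.capList` is the instance `PP = ppList`, `c = cap`); no new definition is introduced — the laws write this term out. -/

/-- A member `v` of `PP` dividing `E` occurs at least `c v` times in the cap multiset of `(PP.filter (· ∣ E)).map fun w => (w, c w)`. -/
theorem le_count_capMS_filterMap {c : ℕ → ℕ} {E v : ℕ} :
    ∀ {PP : List ℕ}, v ∈ PP → v ∣ E → c v ≤ Multiset.count v (capMS ((PP.filter (· ∣ E)).map fun w => (w, c w)))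
  | [], hv, _ => absurd hv List.not_mem_nil
  | w :: PP, hv, hE => by
      have ih : v ∈ PP → c v ≤ Multiset.count v (capMS ((PP.filter (· ∣ E)).map fun w => (w, c w))) :=
        fun hv' => le_count_capMS_filterMap (c := c) (PP := PP) hv' hE
      rw [List.filter_cons]
      by_cases hw : w ∣ E
      · rw [if_pos (by simpa using hw), List.map_cons]
        simp only [capMS, Multiset.count_add, Multiset.count_replicate]
        rcases List.mem_cons.1 hv with rfl | hv'
        · simp
        · have := ih hv'
          split_ifs <;> omega
      · rw [if_neg (by simpa using hw)]
        rcases List.mem_cons.1 hv with rfl | hv'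
        · exact absurd hE hw
        · exact ih hv'

/-- **Hypothesis (i) of the bridge from two finite tables.** If every prime power `p^k ≤ Emax` (`p ∈ P`, `k ≥ 1`) is listed in `PP`, and every
`v ∈ PP` satisfies `N ≤ v ^ c v`, then the cap lists `(PP.filter (· ∣ E)).map fun w => (w, c w)` satisfy hypothesis (i) of
`exists_seed_emb_of_core`. [folklore] -/
theorem cap_hyp_of_filterMap (P : ℕ → Prop) {N Emax : ℕ} (PP : List ℕ) (c : ℕ → ℕ)
    (hPP : ∀ p k : ℕ, p.Prime → P p → 0 < k → p ^ k ≤ Emax → p ^ k ∈ PP) (hc : ∀ v ∈ PP, N ≤ v ^ c v) :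
    ∀ E ∈ List.range' 1 Emax, ∀ p k : ℕ, p.Prime → P p → 0 < k → p ^ k ∣ E →
      N ≤ (p ^ k) ^ Multiset.count (p ^ k) (capMS ((PP.filter (· ∣ E)).map fun w => (w, c w))) := by
  intro E hE p k hp hPp hk hdvd
  obtain ⟨hE1, hE2⟩ := List.mem_range'_1.1 hE
  have hle : p ^ k ≤ Emax := le_trans (Nat.le_of_dvd (by omega) hdvd) (by omega)
  have hmem := hPP p k hp hPp hk hle
  calc N ≤ (p ^ k) ^ c (p ^ k) := hc _ hmem
    _ ≤ (p ^ k) ^ Multiset.count (p ^ k) (capMS ((PP.filter (· ∣ E)).map fun w => (w, c w))) :=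
        Nat.pow_le_pow_right (pow_pos hp.pos k) (le_count_capMS_filterMap hmem hdvd)

/-! ## 3. Transport of a family from the embedded seed -/

/-- Transport of an STPP family of any size pattern `(a, b, c)^k` along an injective additive hom (`IsSTPP.image` + injectivity of
`Finset.image`). [cite: CohnKleinbergSzegedyUmans2005, Def. 5.1] -/
theorem exists_isSTPP_cards_of_injective {H K : Type*} [AddCommGroup H] [AddCommGroup K] {k a b c : ℕ} (φ : H →+ K)
    (hφ : Function.Injective φ)
    (h : ∃ A B C : Fin k → Finset H, IsSTPP A B C ∧ ∀ i, (A i).card = a ∧ (B i).card = b ∧ (C i).card = c) :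
    ∃ A B C : Fin k → Finset K, IsSTPP A B C ∧ ∀ i, (A i).card = a ∧ (B i).card = b ∧ (C i).card = c := by
  classical
  obtain ⟨A, B, C, hS, hc⟩ := h
  refine ⟨fun i => (A i).image φ, fun i => (B i).image φ, fun i => (C i).image φ, hS.image φ hφ, fun i => ?_⟩
  obtain ⟨h1, h2, h3⟩ := hc i
  exact ⟨by rw [card_image_of_injective _ hφ, h1], by rw [card_image_of_injective _ hφ, h2], by rw [card_image_of_injective _ hφ, h3]⟩

/-- **GENERIC ORDER-LAW STEP (small exponent).** Under the hypotheses of `exists_seed_emb_of_core`, if every seed type of `L` hosts an STPP family of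
size pattern `(a, b, c)^k`, then so does every finite abelian group with prime divisors in `P`, exponent `≤ Emax` and order `≥ N`.
[cite: CohnKleinbergSzegedyUmans2005, Def. 5.1] -/
theorem exists_isSTPP_cards_of_core (P : ℕ → Prop) {N Emax k a b c : ℕ} (CL : ℕ → List (ℕ × ℕ)) {L : List (List ℕ)}
    (hcap : ∀ E ∈ List.range' 1 Emax, ∀ p j : ℕ, p.Prime → P p → 0 < j → p ^ j ∣ E →
      N ≤ (p ^ j) ^ Multiset.count (p ^ j) (capMS (CL E)))
    (hcore : ∀ E ∈ List.range' 1 Emax, ∀ M ∈ subMS (CL E), N ≤ M.prod → ∃ s ∈ L, dom s M = true)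
    (hL : ∀ s ∈ L, ∃ A B C : Fin k → Finset (SeedType s), IsSTPP A B C ∧ ∀ i, (A i).card = a ∧ (B i).card = b ∧ (C i).card = c)
    {G : Type*} [AddCommGroup G] [Finite G] (hP : ∀ p : ℕ, p.Prime → p ∣ Nat.card G → P p)
    (hexp : AddMonoid.exponent G ≤ Emax) (hG : N ≤ Nat.card G) :
    ∃ A B C : Fin k → Finset G, IsSTPP A B C ∧ ∀ i, (A i).card = a ∧ (B i).card = b ∧ (C i).card = c := by
  obtain ⟨s, hs, φ, hφ⟩ := exists_seed_emb_of_core P CL hcap hcore hP hexp hG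
  exact exists_isSTPP_cards_of_injective φ hφ (hL s hs)

/-! ## 4. The large-exponent branch, generic -/

/-- **GENERIC ORDER-LAW STEP (large exponent).** If `ℤ/m` hosts an STPP family of size pattern `(a, b, c)^k` for every `m ≥ R` satisfying `Q m`,
then so does every abelian group whose exponent `E` satisfies `R ≤ E` and `Q E` (an element of order `E` spans an embedded `ℤ/E`; transport along
`zmod_lift_zmultiples_injective`). [cite: CohnKleinbergSzegedyUmans2005, Def. 5.1] -/
theorem exists_isSTPP_cards_of_exponent_ge {k a b c R : ℕ} (Q : ℕ → Prop)
    (hray : ∀ m : ℕ, R ≤ m → Q m → ∃ A B C : Fin k → Finset (ZMod m), IsSTPP A B C ∧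
      ∀ i, (A i).card = a ∧ (B i).card = b ∧ (C i).card = c)
    {G : Type*} [AddCommGroup G] [Finite G] (hexp : R ≤ AddMonoid.exponent G) (hQ : Q (AddMonoid.exponent G)) :
    ∃ A B C : Fin k → Finset G, IsSTPP A B C ∧ ∀ i, (A i).card = a ∧ (B i).card = b ∧ (C i).card = c := by
  obtain ⟨g, hg⟩ := AddMonoid.exists_addOrderOf_eq_exponent (AddMonoid.ExponentExists.of_finite (G := G))
  exact exists_isSTPP_cards_of_injective _ (zmod_lift_zmultiples_injective g)
    (hray (addOrderOf g) (by rw [hg]; exact hexp) (by rw [hg]; exact hQ))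

/-! ## 5. The bridge with MINIMAL capped multisets (appended)

The kernel's `dom` search is cheap on small multisets and expensive on large ones; since domination is monotone, the core only needs to hold for
multisets that are MINIMAL for the property «product `≥ N`» (removing any element drops the product below `N`), which have few elements.  The
variants below add the hypothesis `∀ x ∈ M, M.prod < N * x` (minimality) to the core; the bridge extracts a minimal sub-multiset first. -/

/-- Below every multiset of naturals with product `≥ N` there is one that is minimal for this property: product `≥ N`, and
`M'.prod < N * x` for every `x ∈ M'` (so that erasing `x` drops the product below `N`). [folklore] -/
theorem exists_le_minimal_prod_ge (N : ℕ) : ∀ (M : Multiset ℕ), N ≤ M.prod →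
    ∃ M' ≤ M, N ≤ M'.prod ∧ ∀ x ∈ M', M'.prod < N * x := by
  intro M
  induction hn : Multiset.card M using Nat.strong_induction_on generalizing M with
  | _ n ih =>
    intro hM
    by_cases hmin : ∀ x ∈ M, M.prod < N * x
    · exact ⟨M, le_rfl, hM, hmin⟩
    · push Not at hmin
      obtain ⟨x, hx, hNx⟩ := hmin
      have hpe : x * (M.erase x).prod = M.prod := Multiset.prod_erase hx
      by_cases hN : N = 0
      · exact ⟨0, Multiset.zero_le M, by simp [hN], fun x hx0 => absurd hx0 (Multiset.notMem_zero x)⟩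
      have hx0 : 0 < x := by
        rcases Nat.eq_zero_or_pos x with h0 | h0
        · exfalso
          rw [h0, zero_mul] at hpe
          rw [← hpe] at hM
          exact hN (Nat.le_zero.1 hM)
        · exact h0
      have hE : N ≤ (M.erase x).prod := by
        have : N * x ≤ x * (M.erase x).prod := by rw [hpe]; exact hNx
        rw [mul_comm N x] at this
        exact Nat.le_of_mul_le_mul_left this hx0
      have hcard : Multiset.card (M.erase x) < n := by
        rw [Multiset.card_erase_of_mem hx, ← hn]
        exact Nat.pred_lt (by rw [hn]; intro h0; rw [Multiset.card_eq_zero.1 (hn.trans h0)] at hx; exact Multiset.notMem_zero x hx)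
      obtain ⟨M', hM'le, hM'N, hM'min⟩ := ih _ hcard (M.erase x) rfl hE
      exact ⟨M', hM'le.trans (Multiset.erase_le x M), hM'N, hM'min⟩

/-- **GENERIC SEED BRIDGE, MINIMAL FORM.** As `exists_seed_emb_of_core`, but the domination core (ii) is only required for capped multisets that are
minimal for «product `≥ N`» (`∀ x ∈ M, M.prod < N * x`) — the kernel then only searches small multisets. [folklore] -/
theorem exists_seed_emb_of_core_min (P : ℕ → Prop) {N Emax : ℕ} (CL : ℕ → List (ℕ × ℕ)) {L : List (List ℕ)}
    (hcap : ∀ E ∈ List.range' 1 Emax, ∀ p k : ℕ, p.Prime → P p → 0 < k → p ^ k ∣ E →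
      N ≤ (p ^ k) ^ Multiset.count (p ^ k) (capMS (CL E)))
    (hcore : ∀ E ∈ List.range' 1 Emax, ∀ M ∈ subMS (CL E), N ≤ M.prod → (∀ x ∈ M, M.prod < N * x) → ∃ s ∈ L, dom s M = true)
    {G : Type*} [AddCommGroup G] [Finite G] (hP : ∀ p : ℕ, p.Prime → p ∣ Nat.card G → P p)
    (hexp : AddMonoid.exponent G ≤ Emax) (hG : N ≤ Nat.card G) :
    ∃ s ∈ L, ∃ φ : SeedType s →+ G, Function.Injective φ := by
  classical
  obtain ⟨ι, _, p, hp, e, ⟨g⟩⟩ := AddCommGroup.equiv_directSum_zmod_of_finite G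
  let f : G ≃+ (Π i, ZMod (p i ^ e i)) :=
    g.trans (DirectSum.linearEquivFunOnFintype ℕ ι (fun i => ZMod (p i ^ e i))).toAddEquiv
  have hE1 : 1 ≤ AddMonoid.exponent G := Nat.pos_of_ne_zero AddMonoid.exponent_ne_zero_of_finite
  have hdvd : ∀ i, p i ^ e i ∣ AddMonoid.exponent G := fun i => by
    have hinj : Function.Injective (AddMonoidHom.single (fun j => ZMod (p j ^ e j)) i) :=
      Pi.single_injective (M := fun j => ZMod (p j ^ e j)) i
    have h1 : addOrderOf (f.symm (AddMonoidHom.single (fun j => ZMod (p j ^ e j)) i 1)) = p i ^ e i := by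
      rw [AddEquiv.addOrderOf_eq, addOrderOf_injective _ hinj, ZMod.addOrderOf_one]
    rw [← h1]
    exact AddMonoid.addOrder_dvd_exponent _
  have hq0 : ∀ i, p i ^ e i ≠ 0 := fun i => pow_ne_zero _ (hp i).ne_zero
  set M : Multiset ℕ := (Finset.univ.filter fun i => 0 < e i).val.map fun i => p i ^ e i with hM
  have hprodeq : M.prod = ∏ i, p i ^ e i := by
    rw [hM, ← Finset.prod_eq_multiset_prod]
    exact Finset.prod_filter_of_ne fun i _ hi => Nat.pos_of_ne_zero fun h0 => hi (by rw [h0, pow_zero])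
  have hcardeq : Nat.card G = ∏ i, p i ^ e i := by
    rw [Nat.card_congr f.toEquiv, Nat.card_pi]
    simp [Nat.card_zmod]
  have hEI : AddMonoid.exponent G ∈ List.range' 1 Emax := List.mem_range'_1.2 ⟨hE1, by omega⟩
  set C := capMS (CL (AddMonoid.exponent G)) with hC
  have hprodN : N ≤ M.prod := by rw [hprodeq, ← hcardeq]; exact hG
  have hmemM : ∀ a ∈ M, ∃ i, 0 < e i ∧ a = p i ^ e i := by
    intro a ha
    obtain ⟨i, hi, rfl⟩ := Multiset.mem_map.1 ha
    exact ⟨i, (Finset.mem_filter.1 hi).2, rfl⟩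
  have hpos : ∀ a ∈ M, 1 ≤ a := by
    intro a ha
    obtain ⟨i, hi, rfl⟩ := hmemM a ha
    exact Nat.one_le_iff_ne_zero.2 (hq0 i)
  have hcapM : ∀ a ∈ M, N ≤ a ^ Multiset.count a C := by
    intro a ha
    obtain ⟨i, hi, rfl⟩ := hmemM a ha
    have hPi : P (p i) := hP (p i) (hp i) (by
      rw [hcardeq]
      exact dvd_trans (dvd_pow_self (p i) hi.ne') (Finset.dvd_prod_of_mem _ (Finset.mem_univ i)))
    exact hcap _ hEI (p i) (e i) (hp i) hPi hi (hdvd i)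
  have hcapd := prod_inter_ge_of (C := C) hprodN hpos hcapM
  obtain ⟨M', hM'le, hM'N, hM'min⟩ := exists_le_minimal_prod_ge N (M ∩ C) hcapd
  have hsub : M' ∈ subMS (CL (AddMonoid.exponent G)) := mem_subMS_of_le _ _ (hM'le.trans Multiset.inter_le_right)
  obtain ⟨s, hs, hD⟩ := hcore _ hEI M' hsub hM'N hM'min
  obtain ⟨φ, hφ, -⟩ := exists_emb_of_dom (fun i => p i ^ e i) hq0 s _
    (dom_mono s (hM'le.trans Multiset.inter_le_left) hD)
  exact ⟨s, hs, f.symm.toAddMonoidHom.comp φ, f.symm.injective.comp hφ⟩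

/-- **GENERIC ORDER-LAW STEP (small exponent), MINIMAL FORM.** [cite: CohnKleinbergSzegedyUmans2005, Def. 5.1] -/
theorem exists_isSTPP_cards_of_core_min (P : ℕ → Prop) {N Emax k a b c : ℕ} (CL : ℕ → List (ℕ × ℕ)) {L : List (List ℕ)}
    (hcap : ∀ E ∈ List.range' 1 Emax, ∀ p j : ℕ, p.Prime → P p → 0 < j → p ^ j ∣ E →
      N ≤ (p ^ j) ^ Multiset.count (p ^ j) (capMS (CL E)))
    (hcore : ∀ E ∈ List.range' 1 Emax, ∀ M ∈ subMS (CL E), N ≤ M.prod → (∀ x ∈ M, M.prod < N * x) → ∃ s ∈ L, dom s M = true)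
    (hL : ∀ s ∈ L, ∃ A B C : Fin k → Finset (SeedType s), IsSTPP A B C ∧ ∀ i, (A i).card = a ∧ (B i).card = b ∧ (C i).card = c)
    {G : Type*} [AddCommGroup G] [Finite G] (hP : ∀ p : ℕ, p.Prime → p ∣ Nat.card G → P p)
    (hexp : AddMonoid.exponent G ≤ Emax) (hG : N ≤ Nat.card G) :
    ∃ A B C : Fin k → Finset G, IsSTPP A B C ∧ ∀ i, (A i).card = a ∧ (B i).card = b ∧ (C i).card = c := by
  obtain ⟨s, hs, φ, hφ⟩ := exists_seed_emb_of_core_min P CL hcap hcore hP hexp hG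
  exact exists_isSTPP_cards_of_injective φ hφ (hL s hs)

end Summit.MatrixMultiplication.OmegaCensus
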